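import Summits.CriticalPhenomena.CardyFormulaZ2.Theorems.CardyIKTransportIKLinearTransportSDEPlumb1
import Summits.CriticalPhenomena.CardyFormulaZ2.Theorems.CardyIKTransportIKLinearTransportSDECore1

/-!
# Stub `stub_StripDiagramExchange` — plumbing part 2: coding the gauge bits as one product space

Continues `…SDEPlumb1`. The five independent bit fields of the gauge `μIK` (column bits, row bits, biased plaquettes,
fair plaquettes, diagonal coins) are coded as ONE family of independent Bernoulli bits `SDE.KJ = SDE.JIdx → Bool` with
product law `SDE.PJ` (`SDE.map_code : μIK.map SDE.code = SDE.PJ`, by uniqueness of product measures on boxes), and the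
column-`i`-anchored observables factor through the coding (`SDE.obsA_eq`).
-/

set_option autoImplicit false

noncomputable section

namespace Summit.CriticalPhenomena.CardyFormulaZ2.Theorems.IKLinearTransport.PinnedDiagramExchange

open scoped Classical MeasureTheory ENNReal ProbabilityTheory BigOperators
open MeasureTheory Literature.Probability.Percolation Literature.Probability.LatticeModels

namespace SDE

/-! ## §1 Coding a site configuration, and products of coded factors -/

/-- A site configuration as a family of bits. [folklore] -/
def cset {V : Type*} (ω : Set V) : V → Bool := fun v => decide (v ∈ ω)

/-- `cset` is measurable. [folklore] -/
theorem measurable_cset (V : Type*) : Measurable (cset : Set V → V → Bool) :=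
  measurable_pi_lambda _ fun v => (measurable_from_top (f := fun P : Prop => decide P)).comp (measurable_set_mem v)

/-- The Bernoulli law on `Prop` codes to the Bernoulli law on `Bool`. [folklore] -/
theorem map_decide_bernoulliProp (p : unitInterval) :
    (bernoulliProp p).map (fun P : Prop => decide P) = (Ber(true, false, p) : Measure Bool) := by
  refine Measure.ext_of_singleton fun t => ?_
  rw [Measure.map_apply measurable_from_top (measurableSet_singleton t)]
  cases t
  · have e : (fun P : Prop => decide P) ⁻¹' {false} = {P : Prop | ¬ P} := by ext P; simp
    rw [e, bernoulliProp, ProbabilityTheory.bernoulliMeasure_apply_of_notMem_of_mem p MeasurableSpace.measurableSet_top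
      (by simp) (by simp), ProbabilityTheory.bernoulliMeasure_apply_of_notMem_of_mem p (measurableSet_singleton _)
      (by simp) (by simp)]
  · have e : (fun P : Prop => decide P) ⁻¹' {true} = {P : Prop | P} := by ext P; simp
    rw [e, bernoulliProp, ProbabilityTheory.bernoulliMeasure_apply_of_mem_of_notMem p MeasurableSpace.measurableSet_top
      (by simp) (by simp), ProbabilityTheory.bernoulliMeasure_apply_of_mem_of_notMem p (measurableSet_singleton _)
      (by simp) (by simp)]

/-- BASE CASE: site percolation codes to a product of Bernoulli bits. [folklore] -/
theorem map_cset_sitePercolation (V : Type*) (p : unitInterval) :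
    (sitePercolation V p).map cset = Measure.infinitePi (fun _ : V => (Ber(true, false, p) : Measure Bool)) := by
  rw [sitePercolation_eq_map, Measure.map_map (measurable_cset V) measurable_setOf]
  have e : cset ∘ (fun χ : V → Prop => {v | χ v}) = fun (χ : V → Prop) (v : V) => decide (χ v) := by
    funext χ; funext v; simp [cset]
  rw [e, sitePi, Measure.infinitePi_map_pi _ (f := fun (_ : V) (P : Prop) => decide P) fun _ => measurable_from_top]
  simp only [map_decide_bernoulliProp]

/-- Families of probability measures indexed by a sum type. [folklore] -/
instance isProbabilityMeasure_sum_elim {α β : Type*} (wA : α → Measure Bool) (wB : β → Measure Bool)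
    [∀ a, IsProbabilityMeasure (wA a)] [∀ b, IsProbabilityMeasure (wB b)] (j : α ⊕ β) :
    IsProbabilityMeasure (Sum.elim wA wB j) := by
  cases j <;> dsimp <;> infer_instance

/-- INDUCTIVE STEP: the product of two coded factors codes to the product over the sum of the index types. [folklore] -/
theorem map_prod_elim {A B α β : Type*} [MeasurableSpace A] [MeasurableSpace B] (μA : Measure A) (μB : Measure B)
    [SFinite μA] [SFinite μB] (cA : A → α → Bool) (cB : B → β → Bool) (hA : Measurable cA) (hB : Measurable cB)
    (wA : α → Measure Bool) (wB : β → Measure Bool) [∀ a, IsProbabilityMeasure (wA a)] [∀ b, IsProbabilityMeasure (wB b)]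
    (hlA : μA.map cA = Measure.infinitePi wA) (hlB : μB.map cB = Measure.infinitePi wB) :
    (μA.prod μB).map (fun p => Sum.elim (cA p.1) (cB p.2)) = Measure.infinitePi (Sum.elim wA wB) := by
  have hmeas : Measurable (fun p : A × B => Sum.elim (cA p.1) (cB p.2)) := measurable_pi_lambda _ fun j => by
    cases j with
    | inl x => exact (measurable_pi_apply x).comp (hA.comp measurable_fst)
    | inr y => exact (measurable_pi_apply y).comp (hB.comp measurable_snd)
  refine Measure.eq_infinitePi _ fun s t ht => ?_
  rw [Measure.map_apply hmeas (MeasurableSet.pi s.countable_toSet fun j _ => ht j)]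
  have hpre : (fun p : A × B => Sum.elim (cA p.1) (cB p.2)) ⁻¹' Set.pi ↑s t =
      (cA ⁻¹' Set.pi ↑s.toLeft (fun a => t (Sum.inl a))) ×ˢ (cB ⁻¹' Set.pi ↑s.toRight (fun b => t (Sum.inr b))) := by
    ext ⟨a, b⟩
    simp only [Set.mem_preimage, Set.mem_pi, Finset.mem_coe, Set.mem_prod, Finset.mem_toLeft, Finset.mem_toRight]
    constructor
    · intro h; exact ⟨fun x hx => h _ hx, fun y hy => h _ hy⟩
    · rintro ⟨h1, h2⟩ j hj
      cases j with
      | inl x => exact h1 x hj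
      | inr y => exact h2 y hj
  rw [hpre, Measure.prod_prod, ← Measure.map_apply hA (MeasurableSet.pi (Finset.countable_toSet _) fun j _ => ht _),
    ← Measure.map_apply hB (MeasurableSet.pi (Finset.countable_toSet _) fun j _ => ht _), hlA, hlB,
    Measure.infinitePi_pi _ (fun _ _ => ht _), Measure.infinitePi_pi _ (fun _ _ => ht _)]
  conv_rhs => rw [← Finset.toLeft_disjSum_toRight (u := s), Finset.prod_disjSum]
  rfl

/-! ## §2 The coding of the gauge -/

/-- Index of all gauge bits: column bits, row bits, biased plaquettes, fair plaquettes, diagonal coins. [folklore] -/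
abbrev JIdx : Type := ℤ ⊕ (ℤ ⊕ (Site 2 ⊕ (Site 2 ⊕ Site 2)))

/-- The coded gauge space. [folklore] -/
abbrev KJ : Type := JIdx → Bool

/-- Coding of the two plaquette fields and the coins. [folklore] -/
def codeC (p : Set (Site 2) × Set (Site 2)) : Site 2 ⊕ Site 2 → Bool := Sum.elim (cset p.1) (cset p.2)

/-- Coding of the three face fields. [folklore] -/
def codeB (p : Set (Site 2) × (Set (Site 2) × Set (Site 2))) : Site 2 ⊕ (Site 2 ⊕ Site 2) → Bool :=
  Sum.elim (cset p.1) (codeC p.2)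

/-- Coding of the row bits and the face fields. [folklore] -/
def codeA (p : Set ℤ × (Set (Site 2) × (Set (Site 2) × Set (Site 2)))) : ℤ ⊕ (Site 2 ⊕ (Site 2 ⊕ Site 2)) → Bool :=
  Sum.elim (cset p.1) (codeB p.2)

/-- THE CODING of the gauge bits. [folklore] -/
def code (ω : Ω) : KJ := Sum.elim (cset ω.1) (codeA ω.2)

/-- Densities of the coded bits. [folklore] -/
def wJ : JIdx → unitInterval :=
  Sum.elim (fun _ => half) (Sum.elim (fun _ => half) (Sum.elim (fun _ => qI) (Sum.elim (fun _ => half) (fun _ => half))))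

/-- The product law of the coded bits. [folklore] -/
def PJ : Measure KJ := Measure.infinitePi (fun j : JIdx => (Ber(true, false, wJ j) : Measure Bool))

/-- `PJ` is a probability measure. [folklore] -/
instance isProbabilityMeasure_PJ : IsProbabilityMeasure PJ := by
  unfold PJ; infer_instance

/-- Measurability of the coding maps. [folklore] -/
theorem measurable_code : Measurable codeC ∧ Measurable codeB ∧ Measurable codeA ∧ Measurable code := by
  have hC : Measurable codeC := measurable_pi_lambda _ fun j => by
    cases j with
    | inl x => exact (measurable_pi_apply x).comp ((measurable_cset _).comp measurable_fst)
    | inr y => exact (measurable_pi_apply y).comp ((measurable_cset _).comp measurable_snd)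
  have hB : Measurable codeB := measurable_pi_lambda _ fun j => by
    cases j with
    | inl x => exact (measurable_pi_apply x).comp ((measurable_cset _).comp measurable_fst)
    | inr y => exact (measurable_pi_apply y).comp (hC.comp measurable_snd)
  have hA : Measurable codeA := measurable_pi_lambda _ fun j => by
    cases j with
    | inl x => exact (measurable_pi_apply x).comp ((measurable_cset _).comp measurable_fst)
    | inr y => exact (measurable_pi_apply y).comp (hB.comp measurable_snd)
  refine ⟨hC, hB, hA, measurable_pi_lambda _ fun j => ?_⟩
  cases j with
  | inl x => exact (measurable_pi_apply x).comp ((measurable_cset _).comp measurable_fst)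
  | inr y => exact (measurable_pi_apply y).comp (hA.comp measurable_snd)

/-- THE LAW OF THE CODED GAUGE is the product Bernoulli law. [folklore] -/
theorem map_code : μIK.map code = PJ := by
  obtain ⟨hC, hB, hA, -⟩ := measurable_code
  have eC := map_prod_elim (sitePercolation (Site 2) half) (sitePercolation (Site 2) half) cset cset (measurable_cset _)
    (measurable_cset _) _ _ (map_cset_sitePercolation (Site 2) half) (map_cset_sitePercolation (Site 2) half)
  have eB := map_prod_elim (sitePercolation (Site 2) qI) _ cset codeC (measurable_cset _) hC _ _
    (map_cset_sitePercolation (Site 2) qI) eC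
  have eA := map_prod_elim (sitePercolation ℤ half) _ cset codeB (measurable_cset _) hB _ _
    (map_cset_sitePercolation ℤ half) eB
  have e := map_prod_elim (sitePercolation ℤ half) _ cset codeA (measurable_cset _) hA _ _
    (map_cset_sitePercolation ℤ half) eA
  have hμ : μIK = (sitePercolation ℤ half).prod ((sitePercolation ℤ half).prod ((sitePercolation (Site 2) qI).prod
      ((sitePercolation (Site 2) half).prod (sitePercolation (Site 2) half)))) := rfl
  rw [hμ]
  refine e.trans ?_
  unfold PJ
  congr 1
  funext j
  rcases j with x | y | f | f | f <;> rfl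

/-! ## §3 The anchored observables through the coding -/

/-- Plaquette parity read by the `S`-mixed model, on coded bits. [folklore] -/
def parJ (S : Set ℤ) (b : KJ) (f : Site 2) : Bool :=
  (decide (f 0 ∈ S) && b (Sum.inr (Sum.inr (Sum.inl f)))) || (!decide (f 0 ∈ S) && b (Sum.inr (Sum.inr (Sum.inr (Sum.inl f)))))

/-- The column-`i`-anchored observables as a function of the coded bits. [folklore] -/
def ObsJ (i : ℤ) (S : Set ℤ) (b : KJ) : Obs :=
  ({v | Xor (b (Sum.inl (v 0)) = true) (Xor (b (Sum.inr (Sum.inl (v 1))) = true)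
      (Odd ((Finset.filter (fun f : ℤ × ℤ => parJ S b ![f.1, f.2] = true)
        (Finset.Ico (min i (v 0)) (max i (v 0)) ×ˢ Finset.Ico (min 0 (v 1)) (max 0 (v 1)))).card)))},
   {f | f 0 ∉ S ∨ b (Sum.inr (Sum.inr (Sum.inr (Sum.inr f)))) = true})

/-- The plaquette parities through the coding. [folklore] -/
theorem parJ_code (S : Set ℤ) (ω : Ω) (f : Site 2) : parJ S (code ω) f = true ↔ f ∈ parSet S ω := by
  simp only [parJ, code, codeA, codeB, codeC, cset, Sum.elim_inr, Sum.elim_inl, parSet, Set.mem_setOf_eq,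
    Bool.or_eq_true, Bool.and_eq_true, decide_eq_true_eq, Bool.not_eq_true', decide_eq_false_iff_not]

/-- THE ANCHORED OBSERVABLES FACTOR THROUGH THE CODING. [folklore] -/
theorem obsA_eq (i : ℤ) (S : Set ℤ) (ω : Ω) : obsA i S ω = ObsJ i S (code ω) := by
  refine Prod.ext ?_ ?_
  · ext v
    simp only [obsA, blackA, ObsJ, Set.mem_setOf_eq, parJ_code]
    simp only [code, codeA, cset, Sum.elim_inl, Sum.elim_inr, decide_eq_true_eq]
  · ext f
    simp only [obsA, antiSet, ObsJ, Set.mem_setOf_eq, code, codeA, codeB, codeC, cset, Sum.elim_inr, decide_eq_true_eq]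

/-- Hence `νmix S` is the law of `ObsJ i S` under the product law of the coded bits. [folklore] -/
theorem nuMix_eq_map_ObsJ (S : Set ℤ) (i : ℤ) (hO : Measurable (ObsJ i S)) : νmix S = PJ.map (ObsJ i S) := by
  rw [nuMix_eq_map_obsA S i, ← map_code, Measure.map_map hO measurable_code.2.2.2]
  congr 1
  funext ω
  exact obsA_eq i S ω

end SDE

/-- CODING (plumbing part 2 of `stub_StripDiagramExchange`): the gauge bits code to one product Bernoulli space. [folklore] -/
theorem stripDX_coding : μIK.map SDE.code = SDE.PJ :=
  SDE.map_code

end Summit.CriticalPhenomena.CardyFormulaZ2.Theorems.IKLinearTransport.PinnedDiagramExchange
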